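import Summits.BirchSwinnertonDyer.Rank1Residual.GaloisImage.FiniteSingularComparisonField
import Summits.BirchSwinnertonDyer.Rank1Residual.GaloisImage.CanonicalKolyvaginDatum
import Summits.BirchSwinnertonDyer.Rank1Residual.GaloisImage.KolyvaginPrimeLocalShape
import Mathlib.LinearAlgebra.Matrix.Charpoly.Coeff
import Mathlib.FieldTheory.Finiteness
import HarnessLib

/-!
# The canonical finite–singular comparison map is an isomorphism, II: Rubin's operator
# `Q(φ⁻¹)` maps `M/(φ − 1)M` isomorphically onto `M^{φ=1}` (prime modulus)
# (cell `b2b-bsdres`, team n1011, seat p11 gen 4, OWNERS row T-HCC-adm; file 2/5)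

HONEST FRAMING (cell `b2b-bsdres`, run/shared/lean/b2b/bsd-rank1-residual/, verbatim in every
file): the goal of the cell is to DELETE the COMBINATION-SHAPED residual classes of the
Birch–Swinnerton-Dyer formula for ALL analytic-rank `≤ 1` elliptic curves over `ℚ` — "full BSD
formula for every rank `≤ 1` curve in class `C`" assembled STRICTLY from published theorems — so
that the rank-`≤ 1` remainder becomes exactly the CONSTRUCTION-SHAPED classes, which are TYPED
(missing-input `Prop`s), NOT attempted. This is not "finishing BSD". Team n1011 (N10 / N11, the
additive block X4 ∧ `p = 3`): research route on the CONSTRUCTION-SHAPED class X4; no claim beyond the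
stated classes; nothing is booked. TOOL theorems of linear algebra; no definition, no named fact,
no `sorry`.

## What is proved

For a discrete `Γ_F`-module `M`, free of finite rank over `ℤ/N`, and `φ ∈ Γ_F`, the tree's
`ρ.comparisonP N φ = P(x) = det(1 − φx | M)` (Rubin PCMI Def. 1.9.6; `rubinP`, the reversed
characteristic polynomial) and `ρ.comparisonOp N φ = Q(φ⁻¹)`, `(x − 1)Q(x) = P(x)`
(`FiniteSingularComparison.lean`, n1011-lit; `FiniteSingularComparisonAlgebra.lean`, n1011-p04):

* `FSComp.comparisonP_eq_C_mul_charpoly_inv` (any `N`): **`P = C u · χ_{φ⁻¹}`** with `u` a unit of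
  `ℤ/N` (`u = (−1)^r det φ`; Mathlib `Matrix.charpoly_inv`, `Matrix.reverse_charpoly` through a basis);
* at PRIME modulus `p` (`M` an `𝔽_p`-space), from `M/(φ − 1)M ≃ ℤ/p` (the tree's (H.2)-shape
  hypothesis `Nonempty (cokerSubOne ρ φ ≃+ ZMod p)`): `FSComp.finrank_ker_sub_one_eq_one`
  (`dim ker (φ⁻¹ − 1) = 1`), **`FSComp.exists_comparisonOp_eq_of_apply_eq`** (`Q(φ⁻¹)` maps ONTO
  `M^{φ=1}`, by file 1 applied to `φ⁻¹`) and **`FSComp.mem_range_of_comparisonOp_eq_zero`**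
  (`Q(φ⁻¹) m = 0 ⟹ m ∈ (φ − 1)M`, by counting: `#M/(φ − 1)M = #M^{φ=1} = p`).  Together: `Q(φ⁻¹)`
  induces a bijection `M/(φ − 1)M ⥲ M^{φ=1}` — [MR04] Lemma 1.2.3, first map, for `R = 𝔽_p`.

The prime-POWER modulus (`R = ℤ/p^k`, the Nakayama step of the printed proof) is not treated here.

References: B. Mazur, K. Rubin, *Kolyvagin systems*, Mem. AMS 799 (2004), Def. 1.2.2 and Lemma 1.2.3
(pp. 10–11); K. Rubin, PCMI 18 (2011), Def. 1.9.6, Ex. 1.9.7.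
-/

noncomputable section

open Field Polynomial Module
open Literature.NumberTheory.GaloisRepresentations
open Literature.NumberTheory.GaloisRepresentations.DiscreteGaloisModule
open scoped ContRepresentation Polynomial

universe u

namespace Summit.BirchSwinnertonDyer.Rank1Residual.GaloisImage.FSComp

/-! ### §1 `P = C u · χ_{φ⁻¹}` over any `ℤ/N` -/

section AnyModulus

variable {F : Type u} [Field F] {M : Type u} [AddCommGroup M] [TopologicalSpace M]
  [DiscreteTopology M]
variable (ρ : DiscreteGaloisModule F M) (N : ℕ) [Module (ZMod N) M]
  [Module.Free (ZMod N) M] [Module.Finite (ZMod N) M]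

/-- **`P(x) = det(1 − φx | M) = u · χ_{φ⁻¹}(x)` with `u = (−1)^r det φ` a unit** (through a basis:
Mathlib `Matrix.reverse_charpoly` and `Matrix.charpoly_inv`). [folklore] -/
theorem comparisonP_eq_C_mul_charpoly_inv (φ : absoluteGaloisGroup F) :
    ∃ u : ZMod N, IsUnit u ∧ ρ.comparisonP N φ = C u * (ρ.zmodEnd N φ⁻¹).charpoly := by
  classical
  let b := Module.Free.chooseBasis (ZMod N) M
  set A := LinearMap.toMatrix b b (ρ.zmodEnd N φ) with hA
  set G := LinearMap.toMatrix b b (ρ.zmodEnd N φ⁻¹) with hG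
  have hGA : G * A = 1 := by
    rw [hG, hA, ← LinearMap.toMatrix_mul, zmodEnd_inv_mul_self, LinearMap.toMatrix_one]
  have hAG : A * G = 1 := by
    rw [hG, hA, ← LinearMap.toMatrix_mul, zmodEnd_mul_inv_self, LinearMap.toMatrix_one]
  have hdet : IsUnit A.det := Matrix.isUnit_det_of_right_inverse hAG
  have hAu : IsUnit A := (Matrix.isUnit_iff_isUnit_det A).mpr hdet
  have hinv : A⁻¹ = G := Matrix.inv_eq_left_inv hGA
  have hPA : ρ.comparisonP N φ = A.charpolyRev := by
    rw [comparisonP_def, ← LinearMap.charpoly_toMatrix _ b, ← hA, Matrix.reverse_charpoly]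
  have hχG : (ρ.zmodEnd N φ⁻¹).charpoly = G.charpoly := by
    rw [← LinearMap.charpoly_toMatrix _ b, ← hG]
  have hGinv := Matrix.charpoly_inv A hAu
  rw [hinv] at hGinv
  refine ⟨(-1) ^ Fintype.card (Module.Free.ChooseBasisIndex (ZMod N) M) * A.det, ?_, ?_⟩
  · exact ((isUnit_one.neg).pow _).mul hdet
  · rw [hPA, hχG, hGinv, map_mul, map_pow, map_neg, map_one]
    have h1 : C A.det * C (Ring.inverse A.det) = (1 : (ZMod N)[X]) := by
      rw [← map_mul, Ring.mul_inverse_cancel _ hdet, map_one]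
    have hsq : ((-1 : (ZMod N)[X]) ^ Fintype.card (Module.Free.ChooseBasisIndex (ZMod N) M)) *
        (-1) ^ Fintype.card (Module.Free.ChooseBasisIndex (ZMod N) M) = 1 := by
      rw [← pow_add, ← two_mul, pow_mul, neg_one_sq, one_pow]
    linear_combination (-(A.charpolyRev) * (C A.det * C (Ring.inverse A.det))) * hsq +
      (-(A.charpolyRev)) * h1

end AnyModulus

/-! ### §2 Prime modulus: `Q(φ⁻¹)` is onto `M^{φ=1}` and injective modulo `(φ − 1)M` -/

section PrimeModulus

variable {F : Type u} [Field F] {M : Type u} [AddCommGroup M] [TopologicalSpace M]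
  [DiscreteTopology M]
variable (ρ : DiscreteGaloisModule F M) (p : ℕ) [Module (ZMod p) M]

/-- **`ker (φ⁻¹ − 1)` is the fixed space of `φ`** (`φ⁻¹ m = m ↔ φ m = m`). [folklore] -/
theorem mem_ker_zmodEnd_inv_sub_one_iff (φ : absoluteGaloisGroup F) (m : M) :
    m ∈ LinearMap.ker (ρ.zmodEnd p φ⁻¹ - 1) ↔ ρ φ m = m := by
  rw [LinearMap.mem_ker, LinearMap.sub_apply, Module.End.one_apply, zmodEnd_apply, sub_eq_zero]
  constructor
  · intro h
    have h' := congrArg (ρ φ) h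
    rw [← Module.End.mul_apply, ← map_mul, mul_inv_cancel, map_one, Module.End.one_apply] at h'
    exact h'.symm
  · intro h
    have h' := congrArg (ρ φ⁻¹) h
    rw [← Module.End.mul_apply, ← map_mul, inv_mul_cancel, map_one, Module.End.one_apply] at h'
    exact h'.symm

/-- The `ℤ/p`-linear kernel of `φ⁻¹ − 1` and the additive kernel of `φ − id` have the same size.
[folklore] -/
theorem natCard_ker_zmodEnd_inv_sub_one (φ : absoluteGaloisGroup F) :
    Nat.card (LinearMap.ker (ρ.zmodEnd p φ⁻¹ - 1)) =
      Nat.card ((ρ φ : M →ₗ[ℤ] M).toAddMonoidHom - AddMonoidHom.id M).ker := by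
  refine Nat.card_congr (Equiv.subtypeEquivRight fun m => ?_)
  rw [mem_ker_zmodEnd_inv_sub_one_iff, AddMonoidHom.mem_ker, AddMonoidHom.sub_apply,
    LinearMap.toAddMonoidHom_coe, AddMonoidHom.id_apply, sub_eq_zero]

variable [Fact p.Prime] [Module.Free (ZMod p) M] [Module.Finite (ZMod p) M]

omit [Module.Free (ZMod p) M] in
/-- **`dim_{𝔽_p} ker (φ⁻¹ − 1) = 1` when `M/(φ − 1)M ≃ ℤ/p`** (`#ker = #coker = p`). [folklore] -/
theorem finrank_ker_sub_one_eq_one (φ : absoluteGaloisGroup F)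
    (hcok : Nonempty (Literature.NumberTheory.GaloisCohomology.cokerSubOne ρ φ ≃+ ZMod p)) :
    finrank (ZMod p) (LinearMap.ker (ρ.zmodEnd p φ⁻¹ - 1)) = 1 := by
  have hp : p.Prime := Fact.out
  haveI : Finite M := Module.finite_of_finite (ZMod p)
  obtain ⟨e⟩ := hcok
  have hcard : Nat.card (LinearMap.ker (ρ.zmodEnd p φ⁻¹ - 1)) = p := by
    rw [natCard_ker_zmodEnd_inv_sub_one, natCard_ker_eq_natCard_quotient_range,
      Nat.card_congr e.toEquiv, Nat.card_zmod]
  have h := Module.natCard_eq_pow_finrank (K := ZMod p) (V := LinearMap.ker (ρ.zmodEnd p φ⁻¹ - 1))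
  rw [hcard, Nat.card_zmod] at h
  have h' : p ^ 1 = p ^ finrank (ZMod p) (LinearMap.ker (ρ.zmodEnd p φ⁻¹ - 1)) := by
    rw [pow_one]; exact h
  exact (Nat.pow_right_injective hp.two_le h').symm

/-- `P(1) = 0` at prime modulus from `M/(φ − 1)M ≃ ℤ/p` (n1011-p04's
`eval_one_comparisonP_eq_zero_of_cokerSubOne`, restated for convenience). [folklore] -/
theorem eval_one_comparisonP_eq_zero_prime (φ : absoluteGaloisGroup F)
    (hcok : Nonempty (Literature.NumberTheory.GaloisCohomology.cokerSubOne ρ φ ≃+ ZMod p)) :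
    (ρ.comparisonP p φ).eval 1 = 0 :=
  haveI : NeZero p := ⟨(Fact.out : p.Prime).ne_zero⟩
  eval_one_comparisonP_eq_zero_of_cokerSubOne ρ p φ hcok

/-- **`Q = C u · (χ_{φ⁻¹} /ₘ (X − 1))`** at prime modulus when `M/(φ − 1)M ≃ ℤ/p` (both `P` and
`χ_{φ⁻¹}` vanish at `1`; uniqueness of division by the monic `X − 1`). [folklore] -/
theorem comparisonQ_eq_C_mul_divByMonic (φ : absoluteGaloisGroup F)
    (hcok : Nonempty (Literature.NumberTheory.GaloisCohomology.cokerSubOne ρ φ ≃+ ZMod p)) :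
    ∃ u : ZMod p, IsUnit u ∧
      ρ.comparisonQ p φ = C u * ((ρ.zmodEnd p φ⁻¹).charpoly /ₘ (X - C 1)) := by
  obtain ⟨u, hu, hP⟩ := comparisonP_eq_C_mul_charpoly_inv ρ p φ
  refine ⟨u, hu, ?_⟩
  -- `χ_{φ⁻¹}(1) = 0`
  have h1 : ((ρ.zmodEnd p φ⁻¹).charpoly).IsRoot 1 := by
    rw [← Module.End.hasEigenvalue_iff_isRoot_charpoly, Module.End.hasEigenvalue_iff,
      Module.End.eigenspace_def, one_smul]
    intro hbot
    have h := finrank_ker_sub_one_eq_one ρ p φ hcok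
    rw [hbot, finrank_bot] at h
    exact zero_ne_one h
  have hmul : (X - C (1 : ZMod p)) * ((ρ.zmodEnd p φ⁻¹).charpoly /ₘ (X - C 1)) =
      (ρ.zmodEnd p φ⁻¹).charpoly := mul_divByMonic_eq_iff_isRoot.mpr h1
  rw [DiscreteGaloisModule.comparisonQ]
  refine (Polynomial.div_modByMonic_unique _ 0 (monic_X_sub_C (1 : ZMod p)) ⟨?_, ?_⟩).1
  · rw [zero_add, mul_left_comm, hmul, hP]
  · rw [degree_zero, degree_X_sub_C]
    exact WithBot.bot_lt_coe 1

/-- **`Q(φ⁻¹)` maps ONTO `M^{φ=1}`** at prime modulus, when `M/(φ − 1)M ≃ ℤ/p`: the field case of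
[MR04] Lemma 1.2.3 (file 1) applied to `φ⁻¹`, whose fixed vectors are those of `φ`.
[cite: MazurRubin2004, Lemma 1.2.3 (p. 10–11)] [cite: Rubin2011, Exercise 1.9.7 (p. 15)] -/
theorem exists_comparisonOp_eq_of_apply_eq (φ : absoluteGaloisGroup F)
    (hcok : Nonempty (Literature.NumberTheory.GaloisCohomology.cokerSubOne ρ φ ≃+ ZMod p))
    (a : M) (ha : ρ φ a = a) : ∃ m : M, ρ.comparisonOp p φ m = a := by
  obtain ⟨u, hu, hQ⟩ := comparisonQ_eq_C_mul_divByMonic ρ p φ hcok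
  have hrange := range_aeval_divByMonic_charpoly_eq_ker (ρ.zmodEnd p φ⁻¹)
    (finrank_ker_sub_one_eq_one ρ p φ hcok)
  obtain ⟨v, hv⟩ := hu
  -- `v⁻¹ • a` is fixed, hence in the range of `Q₁(φ⁻¹)`
  have hmem : ((v⁻¹ : (ZMod p)ˣ) : ZMod p) • a ∈ LinearMap.ker (ρ.zmodEnd p φ⁻¹ - 1) := by
    rw [mem_ker_zmodEnd_inv_sub_one_iff]
    rw [← ZMod.natCast_zmod_val (((v⁻¹ : (ZMod p)ˣ) : ZMod p)), Nat.cast_smul_eq_nsmul, map_nsmul, ha]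
  rw [← hrange] at hmem
  obtain ⟨m, hm⟩ := hmem
  refine ⟨m, ?_⟩
  rw [comparisonOp_def, hQ, map_mul, aeval_C, Module.End.mul_apply, hm, Module.algebraMap_end_apply,
    ← hv, smul_smul, Units.mul_inv, one_smul]

/-- **`Q(φ⁻¹) m = 0 ⟹ m ∈ (φ − 1)M`** at prime modulus, when `M/(φ − 1)M ≃ ℤ/p`: `Q(φ⁻¹)` kills
`(φ − 1)M` (n1011-p04 `comparisonOp_apply_sub`), so it factors through `M/(φ − 1)M`, of order `p`;
its image is all of `M^{φ=1}` (`exists_comparisonOp_eq_of_apply_eq`), also of order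
`p = #ker (φ − 1) = #coker (φ − 1)`; a surjection between sets of the same finite size is injective.
[cite: MazurRubin2004, Lemma 1.2.3 (p. 10–11)] -/
theorem mem_range_of_comparisonOp_eq_zero (φ : absoluteGaloisGroup F)
    (hcok : Nonempty (Literature.NumberTheory.GaloisCohomology.cokerSubOne ρ φ ≃+ ZMod p))
    (m : M) (hm : ρ.comparisonOp p φ m = 0) :
    m ∈ ((ρ φ : M →ₗ[ℤ] M).toAddMonoidHom - AddMonoidHom.id M).range := by
  classical
  have hp : p.Prime := Fact.out
  haveI : NeZero p := ⟨hp.ne_zero⟩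
  haveI : Finite M := Module.finite_of_finite (ZMod p)
  have h1 : (ρ.comparisonP p φ).eval 1 = 0 := eval_one_comparisonP_eq_zero_prime ρ p φ hcok
  set R := ((ρ φ : M →ₗ[ℤ] M).toAddMonoidHom - AddMonoidHom.id M).range with hR
  set Fix := ((ρ φ : M →ₗ[ℤ] M).toAddMonoidHom - AddMonoidHom.id M).ker with hFix
  -- `T = Q(φ⁻¹)` as an additive map, killing `R`
  set T : M →+ M := (ρ.comparisonOp p φ).toAddMonoidHom with hT
  have hTR : R ≤ T.ker := by
    rintro _ ⟨y, rfl⟩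
    rw [AddMonoidHom.mem_ker, hT, LinearMap.toAddMonoidHom_coe, AddMonoidHom.sub_apply,
      LinearMap.toAddMonoidHom_coe, AddMonoidHom.id_apply]
    exact comparisonOp_apply_sub ρ p φ h1 y
  set Tbar : M ⧸ R →+ M := QuotientAddGroup.lift R T hTR with hTbar
  -- sizes: `#(M ⧸ R) = p`, `#Fix = p`
  obtain ⟨e⟩ := hcok
  have hcardQ : Nat.card (M ⧸ R) = p := by rw [Nat.card_congr e.toEquiv, Nat.card_zmod]
  have hcardFix : Nat.card Fix = p := by
    rw [hFix, natCard_ker_eq_natCard_quotient_range, ← hR, hcardQ]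
  -- the image of `Tbar` contains `Fix`
  have hFixle : Fix ≤ Tbar.range := by
    intro a ha
    have ha' : ρ φ a = a := by
      rw [hFix, AddMonoidHom.mem_ker, AddMonoidHom.sub_apply, LinearMap.toAddMonoidHom_coe,
        AddMonoidHom.id_apply, sub_eq_zero] at ha
      exact ha
    obtain ⟨x, hx⟩ := exists_comparisonOp_eq_of_apply_eq ρ p φ ⟨e⟩ a ha'
    exact ⟨QuotientAddGroup.mk x, by rw [hTbar, QuotientAddGroup.lift_mk, hT, LinearMap.toAddMonoidHom_coe, hx]⟩
  -- counting: `#range ≤ #(M ⧸ R) = p = #Fix ≤ #range`, so the kernel of `Tbar` is trivial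
  have hker : Tbar.ker = ⊥ := by
    have h2 := AddSubgroup.card_eq_card_quotient_mul_card_addSubgroup Tbar.ker
    rw [Nat.card_congr (QuotientAddGroup.quotientKerEquivRange Tbar).toEquiv, hcardQ] at h2
    have hle : p ≤ Nat.card Tbar.range := by
      rw [← hcardFix]
      exact Nat.card_le_card_of_injective (AddSubgroup.inclusion hFixle)
        (AddSubgroup.inclusion_injective hFixle)
    have hker1 : Nat.card Tbar.ker = 1 := by
      have hpos : 0 < Nat.card Tbar.ker := Nat.card_pos
      nlinarith [hp.pos]
    exact AddSubgroup.card_eq_one.mp hker1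
  -- conclude
  have hmk : Tbar (QuotientAddGroup.mk m) = 0 := by
    rw [hTbar, QuotientAddGroup.lift_mk, hT, LinearMap.toAddMonoidHom_coe, hm]
  have hmem : (QuotientAddGroup.mk m : M ⧸ R) ∈ Tbar.ker := hmk
  rw [hker, AddSubgroup.mem_bot, QuotientAddGroup.eq_zero_iff] at hmem
  exact hmem

end PrimeModulus

end Summit.BirchSwinnertonDyer.Rank1Residual.GaloisImage.FSComp

end
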